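import Mathlib.Analysis.Distribution.SchwartzSpace.Fourier
import Mathlib.Analysis.Distribution.AEEqOfIntegralContDiff
import Mathlib.Analysis.Fourier.Inversion
import Mathlib.MeasureTheory.Measure.Haar.InnerProductSpace
import Mathlib.MeasureTheory.Integral.Prod
import Literature.NumberTheory.LFunctions.RudnickSarnakProofs
import HarnessLib

/-!
# Support of a Fourier transform along a linear pull-back, by duality (proved)

Proofs only (no definitions, no named facts). The analytic mechanism behind Rudnick–Sarnak,
*Duke Math. J.* **81** (1996), (4.14): "if `Supp Φ ⊆ {∑ |ξ_j| < r}` then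
`Supp Φ_F ⊆ {∑ |v_j| < r}`" for the pull-back `ι_F^* f_Φ = f_{Φ_F}` of a test function along the
block map of a set partition. In the form used by `RudnickSarnakPullback.lean`
(`fourier_slice_eq_zero_of_pullback`): let `gs` be a Schwartz function on `ℝ^m` which is the
Fourier integral along a linear map `L : ℝ^m → ℝ^k` of a continuous compactly supported `Φ_H`
on `ℝ^k`, `gs(z) = ∫ Φ_H(η) e(−(Lz)·η) dη`; if `h(−Lᵀη) < 2 − δ` on the support of `Φ_H`, where
`h(θ) = |∑_c θ_c| + ∑_c |θ_c|`, then `θ ↦ ∫ gs(z) e(−z·θ) dz` vanishes on `{h > 2 − δ}`.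
Proof: tested against a smooth `ψ` compactly supported in that open set, two applications of
Fubini and Fourier inversion for `ψ` (Mathlib's `𝓕` on `EuclideanSpace ℝ (Fin m)`, transported
by `RudnickSarnak.fourier_euclidean_toLp`) give `∫ Φ_H(η) ψ(−Lᵀη) dη = 0`; hence the transform
vanishes a.e. there (`IsOpen.ae_eq_zero_of_integral_contDiff_smul_eq_zero`) and everywhere by
continuity.

* `RudnickSarnak.norm_cexp_neg_two_pi_I_mul`, `RudnickSarnak.exists_schwartz_fourier`,
  `RudnickSarnak.fourier_slice_eq_zero_of_pullback`.

## References

* Z. Rudnick, P. Sarnak, Duke Math. J. 81 (1996), 269–322, (4.14).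
-/

noncomputable section

open MeasureTheory Complex Filter Topology SchwartzMap Finset
open scoped FourierTransform RealInnerProductSpace Real ContDiff

namespace Literature.NumberTheory.LFunctions

namespace RudnickSarnak

/-- `‖e(−s)‖ = 1` for the phase `e^{-2πi s}`, `s` real. [folklore] -/
theorem norm_cexp_neg_two_pi_I_mul (s : ℝ) : ‖Complex.exp (-(2 * π * I * s))‖ = 1 := by
  rw [Complex.norm_exp]
  simp

/-- Transport of a Schwartz function on `Fin m → ℝ` to `EuclideanSpace ℝ (Fin m)` and back:
the explicit Fourier integral `θ ↦ ∫ g(z) e^{-2πi z·θ} dz` of a Schwartz `g` is the (Schwartz,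
hence continuous and integrable) Fourier transform read through `toLp`. [folklore] -/
theorem exists_schwartz_fourier {m : ℕ} (g : SchwartzMap (Fin m → ℝ) ℂ) :
    ∃ G : SchwartzMap (EuclideanSpace ℝ (Fin m)) ℂ, ∀ θ : Fin m → ℝ,
      G (WithLp.toLp 2 θ) = ∫ z : Fin m → ℝ, g z * Complex.exp (-(2 * π * I * ∑ c, (z c * θ c : ℝ))) := by
  set e : EuclideanSpace ℝ (Fin m) ≃L[ℝ] (Fin m → ℝ) :=
    PiLp.continuousLinearEquiv 2 ℝ (fun _ : Fin m ↦ ℝ) with he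
  set gE : SchwartzMap (EuclideanSpace ℝ (Fin m)) ℂ :=
    SchwartzMap.compCLMOfContinuousLinearEquiv ℂ e g with hgE
  have hgEcoe : (⇑gE : EuclideanSpace ℝ (Fin m) → ℂ) = fun v ↦ g (WithLp.ofLp v) := rfl
  refine ⟨𝓕 gE, fun θ ↦ ?_⟩
  rw [SchwartzMap.fourier_coe, hgEcoe, fourier_euclidean_toLp]

/-- **Support of a Fourier transform by duality.** Let `gs` be a Schwartz function on `ℝ^m`
which is the (inverse-oriented) Fourier transform along a linear map `L : ℝ^m → ℝ^k` of a
continuous compactly supported `Φ_H` on `ℝ^k`, `gs(z) = ∫ Φ_H(η) e(−(Lz)·η) dη`. If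
`h(−Bη) < 2 − δ` whenever `Φ_H(η) ≠ 0`, where `B = Lᵀ` (`(Bη)_c = ∑_i (L e_c)_i η_i`) and
`h(θ) = |∑_c θ_c| + ∑_c |θ_c|`, then the Fourier transform `θ ↦ ∫ gs(z) e(−z·θ) dz` vanishes on
the open set `{h > 2 − δ}`: tested against a smooth `ψ` compactly supported there it gives
`∫ Φ_H(η) ψ(−Bη) dη = 0` (Fubini twice and Fourier inversion for `ψ`), so it vanishes a.e. there
(`IsOpen.ae_eq_zero_of_integral_contDiff_smul_eq_zero`), hence everywhere by continuity.
(The mechanism behind RS (4.14): "if `Supp Φ ⊆ {∑ |ξ_j| < r}` then `Supp Φ_F ⊆ {∑ |v_j| < r}`".)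
[cite: RudnickSarnak1996, (4.14)] -/
theorem fourier_slice_eq_zero_of_pullback {k m : ℕ} {ΦH : (Fin k → ℝ) → ℂ}
    (hΦc : Continuous ΦH) (hΦs : HasCompactSupport ΦH)
    (L : (Fin m → ℝ) →L[ℝ] (Fin k → ℝ)) (gs : SchwartzMap (Fin m → ℝ) ℂ)
    (hgs : ∀ z : Fin m → ℝ, gs z =
      ∫ η : Fin k → ℝ, ΦH η * Complex.exp (-(2 * π * I * ∑ i, ((L z) i * η i : ℝ))))
    {δ : ℝ}
    (hB : ∀ η : Fin k → ℝ, ΦH η ≠ 0 →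
      |∑ c : Fin m, -(∑ i, (L (Pi.single c 1)) i * η i)| +
        ∑ c : Fin m, |-(∑ i, (L (Pi.single c 1)) i * η i)| < 2 - δ)
    (θ : Fin m → ℝ) (hθ : 2 - δ < |∑ c, θ c| + ∑ c, |θ c|) :
    (∫ z : Fin m → ℝ, gs z * Complex.exp (-(2 * π * I * ∑ c, (z c * θ c : ℝ)))) = 0 := by
  -- notation
  set B : (Fin k → ℝ) → (Fin m → ℝ) := fun η c ↦ ∑ i, (L (Pi.single c 1)) i * η i with hBdef
  set hgt : (Fin m → ℝ) → ℝ := fun θ ↦ |∑ c, θ c| + ∑ c, |θ c| with hhgt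
  set U : Set (Fin m → ℝ) := {θ | 2 - δ < hgt θ} with hU
  set F : (Fin m → ℝ) → ℂ :=
    fun θ ↦ ∫ z : Fin m → ℝ, gs z * Complex.exp (-(2 * π * I * ∑ c, (z c * θ c : ℝ))) with hF
  -- `F` is continuous (it is a Schwartz function read through `toLp`)
  obtain ⟨GF, hGF⟩ := exists_schwartz_fourier gs
  have hFcont : Continuous F := by
    have : F = fun θ ↦ GF (WithLp.toLp 2 θ) := by
      funext θ
      rw [hGF]
    rw [this]
    exact GF.continuous.comp (PiLp.continuous_toLp 2 _)
  -- `U` is open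
  have hhcont : Continuous hgt := by
    simp only [hhgt]
    fun_prop
  have hUopen : IsOpen U := isOpen_lt continuous_const hhcont
  -- the key identity `(L z)·η = z·(B η)`
  have hLB : ∀ (z : Fin m → ℝ) (η : Fin k → ℝ), ∑ i, (L z) i * η i = ∑ c, z c * B η c := by
    intro z η
    have hz : (L z : Fin k → ℝ) = ∑ c, z c • L (Pi.single c 1) := by
      have := LinearMap.pi_apply_eq_sum_univ L.toLinearMap z
      simp only [ContinuousLinearMap.coe_coe] at this
      rw [this]
      refine Finset.sum_congr rfl fun c _ ↦ ?_
      congr 1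
      congr 1
      funext j
      simp [Pi.single_apply, eq_comm]
    simp only [hBdef, Finset.mul_sum]
    rw [Finset.sum_comm]
    refine Finset.sum_congr rfl fun i _ ↦ ?_
    have hzi : (L z) i = ∑ c, z c * (L (Pi.single c 1)) i := by
      rw [hz]
      simp [Finset.sum_apply, smul_eq_mul]
    rw [hzi, Finset.sum_mul]
    refine Finset.sum_congr rfl fun c _ ↦ ?_
    ring
  -- test against smooth compactly supported `ψ` with `tsupport ψ ⊆ U`
  have htest : ∀ ψ : (Fin m → ℝ) → ℝ, ContDiff ℝ ∞ ψ → HasCompactSupport ψ → tsupport ψ ⊆ U →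
      ∫ θ, ψ θ • F θ = 0 := by
    intro ψ hψ hψs hψU
    -- `ψ` as a complex Schwartz function on Euclidean space, and its Fourier transform
    set ψC : (Fin m → ℝ) → ℂ := fun θ ↦ (ψ θ : ℂ) with hψC
    have hψCc : Continuous ψC := Complex.continuous_ofReal.comp hψ.continuous
    have hψCs : HasCompactSupport ψC := hψs.comp_left Complex.ofReal_zero
    have hψCd : ContDiff ℝ ∞ ψC := Complex.ofRealCLM.contDiff.comp hψ
    set ψE : EuclideanSpace ℝ (Fin m) → ℂ := fun v ↦ ψC (WithLp.ofLp v) with hψE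
    have hψEs : HasCompactSupport ψE :=
      hψCs.comp_isClosedEmbedding
        (PiLp.continuousLinearEquiv 2 ℝ (fun _ : Fin m ↦ ℝ)).toHomeomorph.isClosedEmbedding
    have hψEd : ContDiff ℝ ∞ ψE :=
      hψCd.comp (PiLp.continuousLinearEquiv 2 ℝ (fun _ : Fin m ↦ ℝ)).contDiff
    set SE : SchwartzMap (EuclideanSpace ℝ (Fin m)) ℂ := hψEs.toSchwartzMap hψEd with hSE
    have hSEcoe : (⇑SE : EuclideanSpace ℝ (Fin m) → ℂ) = ψE := rfl
    set FSE : SchwartzMap (EuclideanSpace ℝ (Fin m)) ℂ := 𝓕 SE with hFSE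
    have hFSEcoe : (⇑FSE : EuclideanSpace ℝ (Fin m) → ℂ) = 𝓕 (⇑SE) := by
      rw [hFSE, SchwartzMap.fourier_coe]
    -- `Ψ z := ∫ ψ(θ) e(−z·θ) dθ = 𝓕 ψE (toLp z)`
    set Ψ : (Fin m → ℝ) → ℂ := fun z ↦ FSE (WithLp.toLp 2 z) with hΨdef
    have hΨ_eq : ∀ z : Fin m → ℝ,
        Ψ z = ∫ θ : Fin m → ℝ, ψC θ * Complex.exp (-(2 * π * I * ∑ c, (θ c * z c : ℝ))) := by
      intro z
      simp only [hΨdef]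
      rw [hFSEcoe, hSEcoe, hψE]
      exact fourier_euclidean_toLp ψC z
    have hΨcont : Continuous Ψ := FSE.continuous.comp (PiLp.continuous_toLp 2 _)
    have hFSEint : Integrable (⇑FSE) (volume : Measure (EuclideanSpace ℝ (Fin m))) :=
      FSE.integrable
    have hΨint : Integrable Ψ :=
      ((PiLp.volume_preserving_toLp (Fin m)).integrable_comp hFSEint.aestronglyMeasurable).2
        hFSEint
    -- Fourier inversion for `ψ`: `∫ Ψ(z) e(−z·w) dz = ψ(−w)`
    have hinv : ∀ w : Fin m → ℝ,
        (∫ z : Fin m → ℝ, Ψ z * Complex.exp (-(2 * π * I * ∑ c, (z c * w c : ℝ)))) =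
          ψC (fun c ↦ -w c) := by
      intro w
      have h1 := fourier_euclidean_toLp Ψ w
      have h2 : (fun v : EuclideanSpace ℝ (Fin m) ↦ Ψ (WithLp.ofLp v)) = 𝓕 (⇑SE) := by
        funext v
        simp only [hΨdef, WithLp.toLp_ofLp]
        rw [hFSEcoe]
      rw [← h1, h2]
      have h3 : (𝓕 (𝓕 (⇑SE)) : EuclideanSpace ℝ (Fin m) → ℂ) (WithLp.toLp 2 w) =
          (𝓕⁻ (𝓕 (⇑SE)) : EuclideanSpace ℝ (Fin m) → ℂ) (-WithLp.toLp 2 w) := by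
        rw [Real.fourierInv_eq_fourier_neg, neg_neg]
      have hint : Integrable (𝓕 (⇑SE)) (volume : Measure (EuclideanSpace ℝ (Fin m))) := by
        rw [← hFSEcoe]
        exact hFSEint
      rw [h3, SE.continuous.fourierInv_fourier_eq SE.integrable hint, hSEcoe, hψE]
      rfl
    -- integrability for the two Fubini steps
    have hgsint : Integrable (⇑gs) := gs.integrable
    have hψCint : Integrable ψC := hψCc.integrable_of_hasCompactSupport hψCs
    have hΦint : Integrable ΦH := hΦc.integrable_of_hasCompactSupport hΦs
    have hI₁ : Integrable (Function.uncurry fun (θ : Fin m → ℝ) (z : Fin m → ℝ) ↦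
        ψC θ * (gs z * Complex.exp (-(2 * π * I * ∑ c, (z c * θ c : ℝ))))) (volume.prod volume) := by
      have hprod := hψCint.mul_prod hgsint
      have hmeas : AEStronglyMeasurable (fun p : (Fin m → ℝ) × (Fin m → ℝ) ↦
          Complex.exp (-(2 * π * I * ∑ c, (p.2 c * p.1 c : ℝ)))) (volume.prod volume) := by
        apply Continuous.aestronglyMeasurable
        fun_prop
      have h := hprod.mul_bdd hmeas (c := 1) (Eventually.of_forall fun p ↦
        (norm_cexp_neg_two_pi_I_mul _).le)
      refine h.congr (Eventually.of_forall fun p ↦ ?_)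
      obtain ⟨θ', z⟩ := p
      simp only [Function.uncurry_apply_pair]
      ring
    have hI₂ : Integrable (Function.uncurry fun (z : Fin m → ℝ) (η : Fin k → ℝ) ↦
        ΦH η * Complex.exp (-(2 * π * I * ∑ c, (z c * B η c : ℝ))) * Ψ z) (volume.prod volume) := by
      have hprod := hΨint.mul_prod hΦint
      have hmeas : AEStronglyMeasurable (fun p : (Fin m → ℝ) × (Fin k → ℝ) ↦
          Complex.exp (-(2 * π * I * ∑ c, (p.1 c * B p.2 c : ℝ)))) (volume.prod volume) := by
        apply Continuous.aestronglyMeasurable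
        simp only [hBdef]
        fun_prop
      have h := hprod.mul_bdd hmeas (c := 1) (Eventually.of_forall fun p ↦
        (norm_cexp_neg_two_pi_I_mul _).le)
      refine h.congr (Eventually.of_forall fun p ↦ ?_)
      obtain ⟨z, η⟩ := p
      simp only [Function.uncurry_apply_pair]
      ring
    -- the computation
    calc ∫ θ, ψ θ • F θ
        = ∫ θ, ∫ z, ψC θ * (gs z * Complex.exp (-(2 * π * I * ∑ c, (z c * θ c : ℝ)))) := by
          refine integral_congr_ae (Eventually.of_forall fun θ ↦ ?_)
          simp only [hF, hψC, Complex.real_smul, ← integral_const_mul]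
      _ = ∫ z, ∫ θ, ψC θ * (gs z * Complex.exp (-(2 * π * I * ∑ c, (z c * θ c : ℝ)))) :=
          integral_integral_swap hI₁
      _ = ∫ z, gs z * Ψ z := by
          refine integral_congr_ae (Eventually.of_forall fun z ↦ ?_)
          simp only [hΨ_eq, ← integral_const_mul]
          refine integral_congr_ae (Eventually.of_forall fun θ ↦ ?_)
          simp only [mul_comm (z _) (θ _)]
          ring
      _ = ∫ z, ∫ η, ΦH η * Complex.exp (-(2 * π * I * ∑ c, (z c * B η c : ℝ))) * Ψ z := by
          refine integral_congr_ae (Eventually.of_forall fun z ↦ ?_)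
          simp only [hgs, hLB, ← integral_mul_const]
      _ = ∫ η, ∫ z, ΦH η * Complex.exp (-(2 * π * I * ∑ c, (z c * B η c : ℝ))) * Ψ z :=
          integral_integral_swap hI₂
      _ = ∫ η, ΦH η * ψC (fun c ↦ -B η c) := by
          refine integral_congr_ae (Eventually.of_forall fun η ↦ ?_)
          simp only
          rw [← hinv (B η), ← integral_const_mul]
          refine integral_congr_ae (Eventually.of_forall fun z ↦ ?_)
          simp only
          ring
      _ = ∫ η : Fin k → ℝ, (0 : ℂ) := by
          refine integral_congr_ae (Eventually.of_forall fun η ↦ ?_)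
          simp only
          by_cases hη : ΦH η = 0
          · rw [hη, zero_mul]
          · have hnot : (fun c ↦ -B η c) ∉ U := by
              simp only [hU, Set.mem_setOf_eq, not_lt, hhgt]
              exact (hB η hη).le
            have hzero : ψ (fun c ↦ -B η c) = 0 :=
              image_eq_zero_of_notMem_tsupport fun h ↦ hnot (hψU h)
            simp [hψC, hzero]
      _ = 0 := by simp
  -- a.e. vanishing on `U`, then everywhere by continuity
  have hae : ∀ᵐ θ' ∂(volume : Measure (Fin m → ℝ)), θ' ∈ U → F θ' = 0 :=
    hUopen.ae_eq_zero_of_integral_contDiff_smul_eq_zero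
      (hFcont.locallyIntegrable.locallyIntegrableOn U) htest
  have hθU : θ ∈ U := hθ
  by_contra hne
  have hVopen : IsOpen (U ∩ F ⁻¹' {0}ᶜ) := hUopen.inter (isOpen_compl_singleton.preimage hFcont)
  have hVpos : 0 < volume (U ∩ F ⁻¹' {0}ᶜ) := hVopen.measure_pos volume ⟨θ, hθU, hne⟩
  have hVzero : volume (U ∩ F ⁻¹' {0}ᶜ) = 0 := by
    rw [ae_iff] at hae
    convert hae using 2
    ext θ'
    simp only [Set.mem_inter_iff, Set.mem_preimage, Set.mem_compl_iff, Set.mem_singleton_iff,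
      Set.mem_setOf_eq, Classical.not_imp]
  exact hVpos.ne' hVzero

end RudnickSarnak

end Literature.NumberTheory.LFunctions

end
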